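import Mathlib
import Summits.Ventures.HodgeRepro.Tier4.Common.Automorphic

/-!
# Tier4/Common/AutomorphicFam — the FAMILY face: endoscopic sides indexed by a type of twists, one `C7Face` whose datum
is «a twist `ν` AND a choice of translates for the `ν`-th witness», with (P) = `∃ ν, (W ν).P` and the per-`ν` seesaw
`Identification` glued (t4-plan-2 g2 S13163 (ii): the interface face of the quantifier repair `P_T4v3`)

Blind re-derivation cell `pub-hodge-repro`, Tier 4 (README §9–§10), seat t4-typer-2 (gen 2).  Target tree path
`lean/Summits/Ventures/HodgeRepro/Tier4/Common/AutomorphicFam.lean`.  Imports `Tier4/Common/Automorphic.lean`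
(`EndoscopicSide`, `EndoscopicSide.toC7Face`; night-2's `C7Face`, `Identification` through it) and typer-1's
`Geometry.lean` (`Witness`, `Witness.Translates`, `Witness.P`) through it.

WHY.  `EndoscopicSide.toC7Face` has `Datum := W.Translates` on ONE fixed witness `W` (the fixed lifts `a` of `P_T4`);
on honest data the characters of Hecke translates of one quadruple are constant in the translate, so night-2's
`AdmissibleFamily.twist_mem` (the anticyclotomic twist family the Tier-3 chain runs over) is realised on a
fixed-witness face only with junk `chars` (plan-2 S13163 (ii)).  Under the quantifier repair the honest face is the
FAMILY face: a type `ι` of twists (the `Xi 𝔭`), a witness `W ν` for each (the lifts of the `ν`-twisted corners at a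
deeper level), and the datum «`ν` and a choice of translates for `W ν`».  This file types it as a `C7Face L` with
`Datum := Σ ν, (W ν).Translates` (`EndoscopicSideFam.toC7Face`), proves **`toC7Face_P : E.toC7Face.P ↔ ∃ ν, (W ν).P`**
(the `∃ a′` of `P_T4v3` read as the `∃ ν` over the family), gives the single-`ν` face `E.atFace ν` (the fixed-witness
face of the `ν`-th member, with `(E.atFace ν).P ↔ (W ν).P`) and the GLUE **`identification_of_forall`**: a seesaw
`Identification` of every member face is one of the family face (doubling is pointwise; `P` and `P′` are both
`∃ ν` of the members').  Everything here is a definition or an unfolding; no mathematics is asserted.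

Nothing here says anything about the status of the Hodge conjecture for CM abelian varieties, which is NOT proved
(HC_CM is NOT proved by anyone in this repository).
-/

set_option autoImplicit false

noncomputable section

namespace Summit.Ventures.HodgeRepro.Tier4.Common

open NumberField PeriodCloser

/-- **The endoscopic side of a FAMILY of witnesses** indexed by the twists `ι`: the shared Hecke interface, seesaw
datum, face propositions, representation type and `U(1)`-characters, and the per-witness choice data (`Admissible`,
`chars`, `torusPeriod`, `betaOf`, the toric-period / compatibility / local-root-number predicates on the family datum
`Σ ν, (W ν).Translates`). -/
structure EndoscopicSideFam (L : Type) [Field L] [NumberField L] [IsCMField L]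
    {Form : Type} [AddCommGroup Form] [Module ℂ Form] {A : FormAlgebra Form} {ι : Type} (W : ι → Witness A) where
  /-- the Hecke-character interface of `L` (shared by the family) -/
  hecke : HeckeInterface L
  /-- the seesaw datum of the face (shared) -/
  seesaw : MuTable.SeesawDatum L
  /-- S4 for the face -/
  S4face : Prop
  /-- the Weil-period witness proposition -/
  WeilPeriodWitness : Prop
  /-- the admissible choices of translates of the `ν`-th witness -/
  Admissible : ∀ ν : ι, (W ν).Translates → Prop
  /-- the four characters of a choice for the `ν`-th witness (the `ν`-twisted characters) -/
  chars : ∀ ν : ι, (W ν).Translates → Fin 4 → hecke.HeckeChar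
  /-- the torus period of a choice for the `ν`-th witness -/
  torusPeriod : ∀ ν : ι, (W ν).Translates → ℂ
  /-- the automorphic representations `τ ⊂ L²([U(W)])` (shared: one group) -/
  Tau : Type
  /-- the `U(1)`-characters (shared) -/
  U1Char : Type
  /-- the theta lift of a `U(1)`-character to `U(W)` -/
  thetaLift : U1Char → Tau
  /-- the `U(1)`-character of a choice -/
  betaOf : ∀ ν : ι, (W ν).Translates → U1Char
  /-- (P′)(i)/(ii) on the family datum -/
  toricPeriodNonzero : Fin 2 → (Σ ν : ι, (W ν).Translates) → Tau → Prop
  /-- (P′)(iii) -/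
  liftNonzero : Tau → Prop
  /-- (E1) on the family datum -/
  Compat : Fin 2 → (Σ ν : ι, (W ν).Translates) → Prop
  /-- (E2) on the family datum -/
  LocalRootCond : Fin 2 → hecke.Place → (Σ ν : ι, (W ν).Translates) → Prop

namespace EndoscopicSideFam

variable {L : Type} [Field L] [NumberField L] [IsCMField L]
  {Form : Type} [AddCommGroup Form] [Module ℂ Form] {A : FormAlgebra Form} {ι : Type} {W : ι → Witness A}
  (E : EndoscopicSideFam L W)

/-- **The family face**: night-2's `C7Face L` with `Datum := Σ ν, (W ν).Translates` («a twist and a choice of the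
Hecke translates of its witness») and `hodgePairing ⟨ν, γ⟩ := (W ν).hodgePairing γ`. -/
def toC7Face : C7Face L where
  toHeckeInterface := E.hecke
  seesaw := E.seesaw
  S4face := E.S4face
  WeilPeriodWitness := E.WeilPeriodWitness
  Datum := Σ ν : ι, (W ν).Translates
  Admissible := fun d => E.Admissible d.1 d.2
  chars := fun d => E.chars d.1 d.2
  hodgePairing := fun d => (W d.1).hodgePairing d.2
  torusPeriod := fun d => E.torusPeriod d.1 d.2
  Tau := E.Tau
  U1Char := E.U1Char
  thetaLift := E.thetaLift
  betaOf := fun d => E.betaOf d.1 d.2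
  toricPeriodNonzero := E.toricPeriodNonzero
  liftNonzero := E.liftNonzero
  Compat := E.Compat
  LocalRootCond := E.LocalRootCond

/-- The datum of the family face. -/
theorem toC7Face_Datum : E.toC7Face.Datum = (Σ ν : ι, (W ν).Translates) := rfl

/-- The Hodge pairing of the family face at `⟨ν, γ⟩` is the `ν`-th witness's. -/
theorem toC7Face_hodgePairing (ν : ι) (γ : (W ν).Translates) :
    E.toC7Face.hodgePairing ⟨ν, γ⟩ = (W ν).hodgePairing γ := rfl

/-- **(P) of the family face is `∃ ν, (W ν).P`** — the existential over the twist family. -/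
theorem toC7Face_P : E.toC7Face.P ↔ ∃ ν : ι, (W ν).P := by
  constructor
  · rintro ⟨⟨ν, γ⟩, h⟩
    exact ⟨ν, γ, h⟩
  · rintro ⟨ν, γ, h⟩
    exact ⟨⟨ν, γ⟩, h⟩

/-- **The single-member face**: the fixed-witness `C7Face` of the `ν`-th member, with the family's shared interface
and the `ν`-slice of the choice data. -/
def atFace (ν : ι) : C7Face L where
  toHeckeInterface := E.hecke
  seesaw := E.seesaw
  S4face := E.S4face
  WeilPeriodWitness := E.WeilPeriodWitness
  Datum := (W ν).Translates
  Admissible := E.Admissible ν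
  chars := E.chars ν
  hodgePairing := (W ν).hodgePairing
  torusPeriod := E.torusPeriod ν
  Tau := E.Tau
  U1Char := E.U1Char
  thetaLift := E.thetaLift
  betaOf := E.betaOf ν
  toricPeriodNonzero := fun i γ τ => E.toricPeriodNonzero i ⟨ν, γ⟩ τ
  liftNonzero := E.liftNonzero
  Compat := fun i γ => E.Compat i ⟨ν, γ⟩
  LocalRootCond := fun i v γ => E.LocalRootCond i v ⟨ν, γ⟩

/-- (P) of the `ν`-th member face is `(W ν).P`. -/
theorem atFace_P (ν : ι) : (E.atFace ν).P ↔ (W ν).P := Iff.rfl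

/-- (P) of the family face is the disjunction of the members'. -/
theorem toC7Face_P_iff_exists_atFace : E.toC7Face.P ↔ ∃ ν : ι, (E.atFace ν).P :=
  E.toC7Face_P

/-- (P′) of the family face is the disjunction of the members' (P′). -/
theorem toC7Face_P'_iff_exists_atFace : E.toC7Face.P' ↔ ∃ ν : ι, (E.atFace ν).P' := by
  constructor
  · rintro ⟨⟨ν, γ⟩, τ, h1, h2⟩
    exact ⟨ν, γ, τ, h1, h2⟩
  · rintro ⟨ν, γ, τ, h1, h2⟩
    exact ⟨⟨ν, γ⟩, τ, h1, h2⟩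

/-- **The per-`ν` seesaw identification glues to the family**: if every member face has a seesaw `Identification`
(doubling + `P ↔ P′`), so has the family face. -/
theorem identification_of_forall (h : ∀ ν : ι, Identification (E.atFace ν)) : Identification E.toC7Face where
  doubling := fun d => (h d.1).doubling d.2
  seesaw := by
    rw [E.toC7Face_P_iff_exists_atFace, E.toC7Face_P'_iff_exists_atFace]
    exact exists_congr fun ν => (h ν).seesaw

end EndoscopicSideFam

end Summit.Ventures.HodgeRepro.Tier4.Common

end
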